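import Summits.Ventures.HSemireg.UntwistCocycleTwistSigmaOne
import Summits.Ventures.HSemireg.HomComplexSigmaSingle
import HarnessLib

/-!
# Venture HSemireg — route R1.0, untwisted reading: rows `q = 0, 1` of `hσ` on the K2 chain's COMPLEX carriers for a
# single sheaf (gs-g4; corollary of `UntwistCocycleTwistSigmaOne.lean` and the anchor `HomComplexSigmaSingle.lean`)

HONEST FRAMING. A two-line corollary joining two landed results; real carriers (`HomComplex.IsISemiregularC` = the K2
chain's predicate on strictly perfect complexes, here for the one-term complex `E₀[0]`). Nothing about any variety;
no gerbe; nothing here says HC, HC_CM or HC_AV is proved.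

* `isISemiregularC_single₀_Iic_one_iff_twist` — **`IsISemiregularC(E₀[0], {0,1}) ↔ IsISemiregularC((E₀⟨c⟩)[0], {0,1})`**
  for every cocycle `c` and every finite locally free `E₀`: the anchor `isISemiregularC_single₀_iff` (gs-g4 g17:
  `IsISemiregularC(E₀[0], I) ↔ IsISemiregular(E₀, I)`) on both sides and the discharged rows `q = 0, 1`
  (`isISemiregular_Iic_one_iff_twist`). The STEP-0 object is a genuine two-term complex: this is a consistency
  anchor only (the complex-carrier Leibniz rule for `HomComplex.sigmaC` is NOT claimed).

## References

* R.-O. Buchweitz, H. Flenner, Compositio Math. 137 (2003), §5 (`I`-semiregular). [BuchweitzFlenner2003]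
-/

noncomputable section

open CategoryTheory AlgebraicGeometry

namespace Summit.Ventures.HSemireg

namespace CocycleTwist

open Literature.AlgebraicGeometry.Modules Literature.AlgebraicGeometry.Motives Literature.AlgebraicGeometry.HodgeTheory
  HomComplex

universe u

variable {S : Type u} [CommRing S] (X : Over (Spec (CommRingCat.of S))) [HasDerivedCategory.{u + 1} X.left.Modules]
  (c : UnitCocycle X.left) (E₀ : X.left.Modules) (hE₀ : IsFiniteLocallyFree E₀)
  (hK : ∀ p, IsFiniteLocallyFree ((single₀ X.left E₀).X p))
  (hK' : ∀ p, IsFiniteLocallyFree ((single₀ X.left (twist c E₀)).X p))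

include hE₀ in
/-- **`{0,1}`-semiregularity of the one-term complexes `E₀[0]` and `(E₀ ⊗ M)[0]` agree** (the K2 chain's predicate
`HomComplex.IsISemiregularC`, window `[0, 0]`), for every cocycle `c`: rows `q = 0, 1` of the Leibniz re-expansion on
real carriers, read through the single-sheaf anchor. [cite: BuchweitzFlenner2003, §5 (I-semiregular)] -/
theorem isISemiregularC_single₀_Iic_one_iff_twist :
    IsISemiregularC X (single₀ X.left E₀) 0 0 hK (Set.Iic 1) ↔
      IsISemiregularC X (single₀ X.left (twist c E₀)) 0 0 hK' (Set.Iic 1) := by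
  rw [isISemiregularC_single₀_iff X E₀ hE₀ hK, isISemiregularC_single₀_iff X (twist c E₀) (isFiniteLocallyFree_twist c hE₀) hK']
  exact isISemiregular_Iic_one_iff_twist c hE₀

end CocycleTwist

end Summit.Ventures.HSemireg

end
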